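import Literature.MathematicalPhysics.QuantumFieldTheory.BalabanImbrieJaffe1984to88.BIJ88Sect5StatementsPart4

/-!
# `BalabanImbrieJaffe1984to88.BIJ88Vj5610Operator` — T. Bałaban, J. Imbrie, A. Jaffe, *Effective action and cluster properties of the
abelian Higgs model*, Commun. Math. Phys. **114** (1988) 257–315 [BalabanImbrieJaffe1988], Sect. 5.6 p. 287 [PDF 31]: the operator
`V_j(Ω)` of **(5.6.10)** COMPUTED at operator level, and the sentence after (5.6.11), verbatim: *"The terms in V_j are small
(O(e_j^{1−α})), bounded kernels, either alone or applied to D_{ũ_{k+1}} or D*_{ũ_{k+1}}."* — PROVED as a structure theorem with kernel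
bounds, on the `j`-lattice carriers of record (r18's covariant derivative `BIJ88Sect3Statements.covD`, r16's covariant block average
`BIJ88Sect5StatementsPart4.covAvg` and its first-order part `F2`, `F₁(w) = e^{w} − 1` = `BIJ88Sect5Statements.F1`).

statement-level skeleton of published theorems with citation tags; proofs where landed; nothing here is a claim about the Yang–Mills mass gap

PDF held: `paper:balaban1988-cmp114-bij-abelian-higgs-effective-action` (journal page = PDF page + 256); p. 287 [PDF 31] read as an
image this session (seat folder `pages/original-p031-x2.png`, CCITT render).

CITATION HEADER (lean-in-tree rule).  Part of the lit-balaban TYPED SKELETON (HOME `run/shared/lean/pub/lit-balaban/`), PHASE-2 proof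
seat p31 gen 10 (unit `lit-balaban-p31-g10`; TAKING line HOME/STATUS.md 2026-08-22T00:11Z).  WHAT IS REPRODUCED: row
`C2.Eq5.6.6-5.6.12` of `HOME/lit-balaban-r16/ROWS-C2-part2.md` (owner r16), members (5.6.8)–(5.6.11) p. 287, verbatim:
*"Next we expand Q_l(ũ_{k+1}ũ), l = 1 or j, j < k, (Q_l(ũ_{k+1}ũ)φ)(y) = Σ_{x∈B_l(y)} L^{−ld}ũ_{k+1}(Γ^{(l)}_{y,x})φ(x)(1 +
Σ_{n=1}^∞ (ie_jζA(Γ^{(l)}_{y,x}))ⁿ/n!) = (Q_l(ũ_{k+1})φ)(y) + (F_{2,l}(Ã, ũ_{k+1})φ)(y). (5.6.8) Inserting this formula into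
|(ψ − Q(ũ_{k+1}ũ)φ)(y)|², we obtain the vertices new to this step. For the covariant derivative on the ζ-lattice, we have
(𝒟_{ũ_{k+1}ũ}φ)(b) = (D_{ũ_{k+1}}φ)(b) + ũ_{k+1,b}F_{1,j}(Ã)φ(b₊). (5.6.9) For the basic quadratic form with Neumann boundary conditions
on Ω giving rise to G_j(Ω), we have −Δ^N_{ũ_{k+1}ũ,Ω} + a_jP_j(ũ_{k+1}ũ) = −Δ^N_{ũ_{k+1},Ω} + a_jP_j(ũ_{k+1}) − V_j(Ω), (5.6.10) where V_j(Ω)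
is obtained by inserting (5.6.8), (5.6.9) into the left-hand side. This leads to an expansion of the scalar field propagator in a
fixed region Ω: G_j(Ω, ũ_{k+1}ũ) = G_j(Ω, ũ_{k+1}) + G_j(Ω, ũ_{k+1})V_jG_j(Ω, ũ_{k+1}ũ). (5.6.11) The terms in V_j are small (O(e_j^{1−α})),
bounded kernels, either alone or applied to D_{ũ_{k+1}} or D*_{ũ_{k+1}}."*  In the tree before this file: (5.6.8) `eq568` and (5.6.9)
`eq569` are proved POINTWISE, `V_j(Ω)` is r16's ring-level `Vj` DEFINED as the difference of the two operators ((5.6.10) by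
definition, `eq5610`), (5.6.11) is the ring identity `eq5611`; p13's `BIJ88Expansion577` treats (5.7.7) at the level of kernel
ENTRIES and records *"the operators D, Q_j, Δ^N of (5.6.10) are not constructed, and 'applied to D_{u_{k+1}} or D*_{u_{k+1}}' is read
as an order-0 coefficient"*.  THIS FILE constructs them.

THE MECHANISM.  On the `j`-lattice `T^{(j)}` (sites `Site P j`, positively oriented bonds `PBond P j`) the covariant derivative
`(D_uφ)(b) = c(u_bφ(b₊) − φ(b₋))` (`covD c u`, `c = ζ⁻¹`) is the bond ← site matrix `dMat c u`; *"the basic quadratic form with Neumann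
boundary conditions on Ω"* `Σ_{b⊂Ω}|(D_uφ)(b)|²` is `φᴴ(D_uᴴχD_u)φ` with `χ` the indicator of the bonds inside `Ω` (`chiN Ω`, r18's
`starB Ω`; `form_lapN`), so `−Δ^N_{u,Ω} = D_uᴴχD_u`; the covariant block average `(Q(U)φ)(y) = Σ_{x∈B(y)} wU(y,x)φ(x)` (`covAvg`) is the
matrix `qMat B w U` and `P_j(u) = Q(U)ᴴQ(U)`.  Multiplying the gauge field by `ũ = e^{a}` bondwise (`a_b = ie_kηÃ_b = ie_jζÃ^ζ_b`, (5.6.6)–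
(5.6.7)) and the transporters by `e^{A(y,x)}` (`A(y,x) = ie_jζÃ(Γ_{y,x})`), (5.6.9) and (5.6.8) read `D_{ue^a} = D_u + M`, `Q(Ue^A) =
Q(U) + F₂` with the KERNELS `M(b,x) = c·u_b·F₁(a_b)·[x = b₊]` and `F₂(y,x) = w·U(y,x)·F₁(A(y,x))·[x ∈ B(y)]` (`eq569_matrix`,
`eq568_matrix`).  Expanding the squares,
  `−Δ^N_{ue^a,Ω} + a_jP_j(Ue^A) = [−Δ^N_{u,Ω} + a_jP_j(U)] − V_j(Ω)`,
  `V_j(Ω) = −(D_uᴴχM + MᴴχD_u + MᴴχM) − a_j(QᴴF₂ + F₂ᴴQ + F₂ᴴF₂)` (`eq5610_matrix`; = r16's `Vj` in the matrix ring, `Vj_eq_vjMat`):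
bounded kernels (`M`, `F₂` and their adjoints) *"either alone"* (`MᴴχM`, `F₂ᴴF₂`, and the `Q`-terms — `Q` is itself a bounded
averaging kernel) *"or applied to D_{ũ_{k+1}}"* (`MᴴχD_u`) *"or D*_{ũ_{k+1}}"* (`D_uᴴχM`).  SIZE: `|M(b,b₊)| ≤ |c|‖F₁(a_b)‖ ≤ 2|c|·s` for
`‖a_b‖ ≤ s ≤ 1` (r16's `norm_F1_le`), and in print's currency `c = ζ⁻¹`, `s = e_jζ·sup|Ã^ζ|`: `2|c|s = 2e_j·sup|Ã^ζ|` — the `ζ⁻¹` of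
the ζ-lattice derivative cancels the `ζ` of the exponent, leaving `O(e_j·p) = O(e_j^{1−α})` for fields bounded by `p ≲ e_j^{−α}`
(`norm_mMat_le_printed`); `|F₂(y,x)| ≤ 2|w|s′`, row sums `≤ 2|w||B(y)|s′ = 2s′` for the normalised weight `w|B(y)| = 1`.

WHAT IS PROVED (0 `sorry`, standard axioms; definitions with bodies + theorems, no `Prop` facts).
* §0 algebra in the matrix ring: `conjTranspose_sandwich_expand`, `conjTranspose_square_expand`.
* §1 the operators: `dMat`/`dMat_mulVec` (= `covD`), `mMat`/`mMat_mulVec`/`mMat_apply_of_ne` (the (5.6.9) kernel, one entry per row),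
  **`eq569_matrix`** (`D_{ue^a} = D_u + M`); `qMat`/`qMat_mulVec` (= `covAvg`), `f2Mat`/`f2Mat_mulVec` (= `F2`), **`eq568_matrix`**
  (`Q(Ue^A) = Q(U) + F₂`); `chiN`, **`form_lapN`** (`φᴴ(D_uᴴχ_ΩD_u)φ = Σ_{b∈Ω*}‖(D_uφ)(b)‖²`: the Neumann form); `hMat` (`−Δ^N + a_jP_j`,
  any bond cut-off `χ`).
* §2 **`eq5610_matrix`** and **`Vj_eq_vjMat`**: (5.6.10) with `V_j(Ω)` COMPUTED (`vjMat`), equal to r16's `Vj` of the four operators;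
  `vjMat_mulVec` (the action on `φ`: kernels alone or composed with `D_u`, `D_uᴴ`).
* §3 the kernel bounds: `norm_mMat_le`, `norm_mMat_mulVec_le`, `norm_f2Mat_le`, `norm_f2Mat_mulVec_le`, `norm_mMat_le_printed`.
* §4 **`eq5611_matrix`**: (5.6.11) for these operators (r16's `eq5611` with (5.6.10) inserted).
HONEST SCOPE.  Finite tori of the `Setup` family; uniform lattice weights (`ζ^d` on sites and bonds of `T^{(j)}`, `1` on the unit
lattice) are absorbed into `c`, `w`, `a_j` (with uniform weights the adjoint is the conjugate transpose up to these factors); the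
cut-off `χ` is any bond matrix (Neumann: `χ = chiN Ω`); `Ω`, the blocks `B(y)`, the transporters `U(y,x) = ũ_{k+1}(Γ_{y,x})` and the
exponents are data; the bound `sup|Ã^ζ| ≤ p` with `e_jζp ≤ 1` is DISPLAYED as hypothesis (print: (5.9.4)/(5.3.1) and p. 290
`|A′(b)| ≤ cp(e_k)`), not derived; *"Thus the regularity properties of G_j(ũ_{k+1}), D_{ũ_{k+1}}G_j(ũ_{k+1}) imply that we can develop
this expansion to any order"* is the resolvent bootstrap of [6] = B4 (tree: `Balaban1983to89.B4Lemma22Reduce231`) and is not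
re-done here; (5.6.12) and `w₆` are the companion file `BIJ88Eq5612W6`.  Unit `lit-balaban-p31` (literature-prover-lit-balaban-p31-
g10-0), 2026-08-22.  NOT summit progress.
-/

namespace Literature.MathematicalPhysics.QuantumFieldTheory.BalabanImbrieJaffe1984to88.BIJ88Vj5610Operator

open Literature.MathematicalPhysics.QuantumFieldTheory.Balaban1983to89
open BIJ88Sect3Statements (covD starB mem_starB)
open BIJ88Sect5Statements (F1 one_add_F1 norm_F1_le eq5611)
open BIJ88Sect5StatementsPart4 (covAvg F2 Vj)
open scoped BigOperators Matrix ComplexConjugate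
open Complex Matrix

noncomputable section

/-! ## §0 Algebra: the square of a perturbed operator in the matrix ring -/

section Algebra

variable {m n : Type*} [Fintype m]

/-- kernel: `(D + M)ᴴχ(D + M) = DᴴχD + (DᴴχM + MᴴχD + MᴴχM)` — inserting (5.6.9) into the Neumann form.
[cite: BalabanImbrieJaffe1988, (5.6.10) p.287] -/
theorem conjTranspose_sandwich_expand (D M : Matrix m n ℂ) (χ : Matrix m m ℂ) :
    (D + M)ᴴ * χ * (D + M) = Dᴴ * χ * D + (Dᴴ * χ * M + Mᴴ * χ * D + Mᴴ * χ * M) := by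
  rw [conjTranspose_add]
  simp only [Matrix.add_mul, Matrix.mul_add]
  abel

/-- kernel: `(Q + F)ᴴ(Q + F) = QᴴQ + (QᴴF + FᴴQ + FᴴF)` — inserting (5.6.8) into `P_j = QᴴQ`.
[cite: BalabanImbrieJaffe1988, (5.6.10) p.287] -/
theorem conjTranspose_square_expand (Q F : Matrix m n ℂ) :
    (Q + F)ᴴ * (Q + F) = Qᴴ * Q + (Qᴴ * F + Fᴴ * Q + Fᴴ * F) := by
  rw [conjTranspose_add]
  simp only [Matrix.add_mul, Matrix.mul_add]
  abel

end Algebra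

/-! ## §1 The operators of (5.6.8)–(5.6.10) as matrices on the `j`-lattice -/

variable {P : Params} {j : ℕ}

/-- The covariant derivative `D_u` on `T^{(j)}` as a bond ← site matrix: the kernel of r18's `covD c u`
(`(D_uφ)(b) = c(u_bφ(b₊) − φ(b₋))`, `c = ζ⁻¹`). [cite: BalabanImbrieJaffe1988, (5.6.9) p.287] -/
def dMat (c : ℝ) (u : PBond P j → ℂ) : Matrix (PBond P j) (Balaban1983to89.Site P j) ℂ :=
  Matrix.of fun b x => (c : ℂ) * (if x = b.tgt then u b else 0) - (c : ℂ) * (if x = b.src then 1 else 0)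

/-- kernel: `dMat c u` acts as `covD c u`. [cite: BalabanImbrieJaffe1988, (5.6.9) p.287] -/
theorem dMat_mulVec (c : ℝ) (u : PBond P j → ℂ) (φ : Balaban1983to89.Site P j → ℂ) (b : PBond P j) :
    (dMat c u *ᵥ φ) b = covD c u φ b := by
  simp only [mulVec, dotProduct, dMat, of_apply, sub_mul, Finset.sum_sub_distrib, mul_ite, mul_zero, ite_mul, zero_mul,
    Finset.sum_ite_eq', Finset.mem_univ, if_true, covD]
  ring

/-- The (5.6.9) perturbation kernel `M(b,x) = c·u_b·F₁(a_b)·[x = b₊]` — *"ũ_{k+1,b}F_{1,j}(Ã)φ(b₊)"* with the lattice factor `c`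
explicit as in r16's `eq569`; one entry per row. [cite: BalabanImbrieJaffe1988, (5.6.9) p.287] -/
def mMat (c : ℝ) (u a : PBond P j → ℂ) : Matrix (PBond P j) (Balaban1983to89.Site P j) ℂ :=
  Matrix.of fun b x => if x = b.tgt then (c : ℂ) * u b * F1 (a b) else 0

/-- kernel: `(Mφ)(b) = c·u_b·F₁(a_b)·φ(b₊)`. [cite: BalabanImbrieJaffe1988, (5.6.9) p.287] -/
theorem mMat_mulVec (c : ℝ) (u a : PBond P j → ℂ) (φ : Balaban1983to89.Site P j → ℂ) (b : PBond P j) :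
    (mMat c u a *ᵥ φ) b = (c : ℂ) * u b * F1 (a b) * φ b.tgt := by
  simp only [mulVec, dotProduct, mMat, of_apply, ite_mul, zero_mul, Finset.sum_ite_eq', Finset.mem_univ, if_true]

/-- kernel: the kernel `M` is supported on `x = b₊` (a bounded LOCAL kernel). [cite: BalabanImbrieJaffe1988, (5.6.9) p.287] -/
theorem mMat_apply_of_ne (c : ℝ) (u a : PBond P j → ℂ) {b : PBond P j} {x : Balaban1983to89.Site P j} (hx : x ≠ b.tgt) :
    mMat c u a b x = 0 := by
  simp [mMat, hx]

/-- **(5.6.9) at operator level**: `D_{ue^{a}} = D_u + M` — the covariant derivative of the perturbed gauge field `ũ_{k+1}ũ`,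
`ũ = e^{a}` bondwise ((5.6.6)–(5.6.7), `a_b = ie_jζÃ^ζ_b`), is that of `ũ_{k+1}` plus the kernel `M` (r16's pointwise `eq569`).
[cite: BalabanImbrieJaffe1988, (5.6.9) p.287] -/
theorem eq569_matrix (c : ℝ) (u a : PBond P j → ℂ) :
    dMat c (fun b => u b * exp (a b)) = dMat c u + mMat c u a := by
  ext b x
  simp only [dMat, mMat, Matrix.add_apply, Matrix.of_apply, F1]
  split_ifs <;> ring

section Blocks

variable {α τ : Type*} [Fintype α] [DecidableEq α]

/-- The covariant block average `(Q(U)φ)(y) = Σ_{x∈B(y)} w·U(y,x)φ(x)` of (5.6.8) as a matrix (unit-lattice site ← fine site):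
the kernel of r16's `covAvg B w U` (blocks `B(y) = B_l(y)`, weight `w = L^{−ld}`, transporters `U(y,x) = ũ_{k+1}(Γ^{(l)}_{y,x})`).
[cite: BalabanImbrieJaffe1988, (5.6.8) p.287] -/
def qMat (B : τ → Finset α) (w : ℝ) (U : τ → α → ℂ) : Matrix τ α ℂ :=
  Matrix.of fun y x => if x ∈ B y then (w : ℂ) * U y x else 0

/-- kernel: `qMat B w U` acts as `covAvg B w U`. [cite: BalabanImbrieJaffe1988, (5.6.8) p.287] -/
theorem qMat_mulVec (B : τ → Finset α) (w : ℝ) (U : τ → α → ℂ) (φ : α → ℂ) (y : τ) :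
    (qMat B w U *ᵥ φ) y = covAvg B w U φ y := by
  simp only [mulVec, dotProduct, qMat, of_apply, ite_mul, zero_mul, Finset.sum_ite_mem, Finset.univ_inter, covAvg]

/-- The first-order part `F₂` of (5.6.8) as a matrix: kernel `F₂(y,x) = w·U(y,x)·F₁(A(y,x))·[x ∈ B(y)]`, `A(y,x) = ie_jζÃ(Γ_{y,x})`
(r16's `F2 B w U A`). [cite: BalabanImbrieJaffe1988, (5.6.8) p.287] -/
def f2Mat (B : τ → Finset α) (w : ℝ) (U A : τ → α → ℂ) : Matrix τ α ℂ :=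
  Matrix.of fun y x => if x ∈ B y then (w : ℂ) * U y x * F1 (A y x) else 0

/-- kernel: `f2Mat B w U A` acts as `F2 B w U A`. [cite: BalabanImbrieJaffe1988, (5.6.8) p.287] -/
theorem f2Mat_mulVec (B : τ → Finset α) (w : ℝ) (U A : τ → α → ℂ) (φ : α → ℂ) (y : τ) :
    (f2Mat B w U A *ᵥ φ) y = F2 B w U A φ y := by
  simp only [mulVec, dotProduct, f2Mat, of_apply, ite_mul, zero_mul, Finset.sum_ite_mem, Finset.univ_inter, F2]
  exact Finset.sum_congr rfl fun x _ => by ring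

omit [Fintype α] in
/-- kernel: `F₂` is supported on the block, `F₂(y,x) = 0` for `x ∉ B(y)` (a bounded LOCAL kernel).
[cite: BalabanImbrieJaffe1988, (5.6.8) p.287] -/
theorem f2Mat_apply_of_not_mem (B : τ → Finset α) (w : ℝ) (U A : τ → α → ℂ) {y : τ} {x : α} (hx : x ∉ B y) :
    f2Mat B w U A y x = 0 := by
  simp [f2Mat, hx]

omit [Fintype α] in
/-- **(5.6.8) at operator level**: `Q(Ue^{A}) = Q(U) + F₂` — the block average with the perturbed transporters
`ũ_{k+1}(Γ_{y,x})e^{A(y,x)}` is that of `ũ_{k+1}` plus the kernel `F₂` (r16's pointwise `eq568`). [cite: BalabanImbrieJaffe1988, (5.6.8) p.287] -/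
theorem eq568_matrix (B : τ → Finset α) (w : ℝ) (U A : τ → α → ℂ) :
    qMat B w (fun y x => U y x * exp (A y x)) = qMat B w U + f2Mat B w U A := by
  ext y x
  simp only [qMat, f2Mat, Matrix.add_apply, Matrix.of_apply, F1]
  split_ifs <;> ring

end Blocks

open Classical in
/-- The Neumann cut-off: the indicator of the bonds `b ⊂ Ω` (both end-points in `Ω`, r18's `starB Ω`) as a diagonal bond matrix.
[cite: BalabanImbrieJaffe1988, (5.6.10) p.287] -/
def chiN (Ω : Finset (Balaban1983to89.Site P j)) : Matrix (PBond P j) (PBond P j) ℂ :=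
  Matrix.diagonal fun b => if b ∈ starB Ω then 1 else 0

open Classical in
/-- **the basic quadratic form with Neumann boundary conditions on `Ω`**: `φᴴ(D_uᴴχ_ΩD_u)φ = Σ_{b⊂Ω}‖(D_uφ)(b)‖²` — so
`−Δ^N_{u,Ω} = D_uᴴχ_ΩD_u` is the operator *"giving rise to G_j(Ω)"*. [cite: BalabanImbrieJaffe1988, (5.6.10) p.287] -/
theorem form_lapN (c : ℝ) (u : PBond P j → ℂ) (Ω : Finset (Balaban1983to89.Site P j)) (φ : Balaban1983to89.Site P j → ℂ) :
    star φ ⬝ᵥ (((dMat c u)ᴴ * chiN Ω * dMat c u) *ᵥ φ) = ∑ b ∈ starB Ω, ((‖covD c u φ b‖ ^ 2 : ℝ) : ℂ) := by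
  have h1 : ((dMat c u)ᴴ * chiN Ω * dMat c u) *ᵥ φ = (dMat c u)ᴴ *ᵥ (chiN Ω *ᵥ (dMat c u *ᵥ φ)) := by
    rw [← mulVec_mulVec, ← mulVec_mulVec]
  rw [h1, dotProduct_mulVec, vecMul_conjTranspose, star_star]
  simp only [dotProduct, chiN, mulVec_diagonal, Pi.star_apply, dMat_mulVec]
  rw [← Finset.sum_filter_add_sum_filter_not Finset.univ (fun b => b ∈ starB Ω)]
  have hz : ∑ b ∈ Finset.univ.filter (fun b => ¬ b ∈ starB Ω), star (covD c u φ b) * ((if b ∈ starB Ω then (1 : ℂ) else 0) * covD c u φ b) = 0 :=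
    Finset.sum_eq_zero fun b hb => by
      rw [Finset.mem_filter] at hb
      simp [hb.2]
  rw [hz, add_zero]
  have hs : Finset.univ.filter (fun b => b ∈ starB Ω) = starB Ω := by
    ext b; simp
  rw [hs]
  refine Finset.sum_congr rfl fun b hb => ?_
  rw [if_pos hb, one_mul, Complex.star_def, ← Complex.normSq_eq_conj_mul_self, Complex.normSq_eq_norm_sq,
    Complex.ofReal_pow]

section Operators

variable {τ : Type*} [Fintype τ]

/-- `−Δ^N_{u,Ω} + a_jP_j(u) = D_uᴴχD_u + a_j·Q(U)ᴴQ(U)` — the operator of (5.6.10) *"giving rise to G_j(Ω)"* (any bond cut-off `χ`;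
Neumann: `χ = chiN Ω`; gauge field `u` on the bonds, transporters `U` along the block contours). [cite: BalabanImbrieJaffe1988, (5.6.10) p.287] -/
def hMat (aj c : ℝ) (u : PBond P j → ℂ) (χ : Matrix (PBond P j) (PBond P j) ℂ) (B : τ → Finset (Balaban1983to89.Site P j)) (w : ℝ)
    (U : τ → Balaban1983to89.Site P j → ℂ) : Matrix (Balaban1983to89.Site P j) (Balaban1983to89.Site P j) ℂ :=
  (dMat c u)ᴴ * χ * dMat c u + (aj : ℂ) • ((qMat B w U)ᴴ * qMat B w U)

/-- **`V_j(Ω)` COMPUTED** — *"obtained by inserting (5.6.8), (5.6.9) into the left-hand side"*: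
`V_j(Ω) = −(D_uᴴχM + MᴴχD_u + MᴴχM) − a_j(QᴴF₂ + F₂ᴴQ + F₂ᴴF₂)` — bounded kernels *"either alone or applied to D_{ũ_{k+1}} or D*_{ũ_{k+1}}"*.
[cite: BalabanImbrieJaffe1988, (5.6.10) p.287] -/
def vjMat (aj c : ℝ) (u a : PBond P j → ℂ) (χ : Matrix (PBond P j) (PBond P j) ℂ) (B : τ → Finset (Balaban1983to89.Site P j)) (w : ℝ)
    (U A : τ → Balaban1983to89.Site P j → ℂ) : Matrix (Balaban1983to89.Site P j) (Balaban1983to89.Site P j) ℂ :=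
  -((dMat c u)ᴴ * χ * mMat c u a + (mMat c u a)ᴴ * χ * dMat c u + (mMat c u a)ᴴ * χ * mMat c u a)
    - (aj : ℂ) • ((qMat B w U)ᴴ * f2Mat B w U A + (f2Mat B w U A)ᴴ * qMat B w U + (f2Mat B w U A)ᴴ * f2Mat B w U A)

/-! ## §2 (5.6.10): the structure of `V_j(Ω)` -/

/-- **(5.6.10) with `V_j(Ω)` computed**: `−Δ^N_{ue^a,Ω} + a_jP_j(Ue^A) = [−Δ^N_{u,Ω} + a_jP_j(U)] − V_j(Ω)`.
[cite: BalabanImbrieJaffe1988, (5.6.10) p.287] -/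
theorem eq5610_matrix (aj c : ℝ) (u a : PBond P j → ℂ) (χ : Matrix (PBond P j) (PBond P j) ℂ)
    (B : τ → Finset (Balaban1983to89.Site P j)) (w : ℝ) (U A : τ → Balaban1983to89.Site P j → ℂ) :
    hMat aj c (fun b => u b * exp (a b)) χ B w (fun y x => U y x * exp (A y x))
      = hMat aj c u χ B w U - vjMat aj c u a χ B w U A := by
  simp only [hMat, vjMat, eq569_matrix, eq568_matrix, conjTranspose_sandwich_expand, conjTranspose_square_expand, smul_add]
  abel

/-- **`V_j(Ω)` is r16's `Vj`** (the ring-level difference `(−Δ^N_u + a_jP_u) − (−Δ^N_{uũ} + a_jP_{uũ})` of `BIJ88Sect5StatementsPart4`) in the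
matrix ring, with `Δ^N_{u,Ω} = −D_uᴴχD_u`, `P = QᴴQ`, `a_j ↦ a_j·1`. [cite: BalabanImbrieJaffe1988, (5.6.10) p.287] -/
theorem Vj_eq_vjMat (aj c : ℝ) (u a : PBond P j → ℂ) (χ : Matrix (PBond P j) (PBond P j) ℂ)
    (B : τ → Finset (Balaban1983to89.Site P j)) (w : ℝ) (U A : τ → Balaban1983to89.Site P j → ℂ) :
    Vj ((aj : ℂ) • (1 : Matrix (Balaban1983to89.Site P j) (Balaban1983to89.Site P j) ℂ))
        (-((dMat c u)ᴴ * χ * dMat c u)) ((qMat B w U)ᴴ * qMat B w U)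
        (-((dMat c (fun b => u b * exp (a b)))ᴴ * χ * dMat c (fun b => u b * exp (a b))))
        ((qMat B w (fun y x => U y x * exp (A y x)))ᴴ * qMat B w (fun y x => U y x * exp (A y x)))
      = vjMat aj c u a χ B w U A := by
  have h := eq5610_matrix aj c u a χ B w U A
  simp only [hMat] at h
  simp only [Vj, neg_neg, smul_mul_assoc, one_mul, h]
  abel

/-- kernel: the action of `V_j(Ω)` on a field — the kernels `M`, `F₂` *"either alone or applied to D_{ũ_{k+1}} or D*_{ũ_{k+1}}"*:
`V_jφ = −[D_uᴴχ(Mφ) + Mᴴχ(D_uφ) + Mᴴχ(Mφ)] − a_j[Qᴴ(F₂φ) + F₂ᴴ(Qφ) + F₂ᴴ(F₂φ)]`. [cite: BalabanImbrieJaffe1988, (5.6.10) p.287] -/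
theorem vjMat_mulVec (aj c : ℝ) (u a : PBond P j → ℂ) (χ : Matrix (PBond P j) (PBond P j) ℂ)
    (B : τ → Finset (Balaban1983to89.Site P j)) (w : ℝ) (U A : τ → Balaban1983to89.Site P j → ℂ) (φ : Balaban1983to89.Site P j → ℂ) :
    vjMat aj c u a χ B w U A *ᵥ φ
      = -((dMat c u)ᴴ *ᵥ (χ *ᵥ (mMat c u a *ᵥ φ)) + (mMat c u a)ᴴ *ᵥ (χ *ᵥ (dMat c u *ᵥ φ))
          + (mMat c u a)ᴴ *ᵥ (χ *ᵥ (mMat c u a *ᵥ φ)))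
        - (aj : ℂ) • ((qMat B w U)ᴴ *ᵥ (f2Mat B w U A *ᵥ φ) + (f2Mat B w U A)ᴴ *ᵥ (qMat B w U *ᵥ φ)
          + (f2Mat B w U A)ᴴ *ᵥ (f2Mat B w U A *ᵥ φ)) := by
  simp only [vjMat, sub_mulVec, neg_mulVec, add_mulVec, smul_mulVec, ← mulVec_mulVec]

/-! ## §3 The kernels are bounded and small -/

/-- **`M` is a bounded kernel of size `O(|c|·s)`**: `‖M(b,x)‖ ≤ |c|·2s` for `|u_b| ≤ 1`, `‖a_b‖ ≤ s ≤ 1` (r16's `norm_F1_le`: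
`‖F₁(w)‖ ≤ 2‖w‖`). [cite: BalabanImbrieJaffe1988, (5.6.11) p.287] -/
theorem norm_mMat_le {c s : ℝ} {u a : PBond P j → ℂ} {b : PBond P j} (hu : ‖u b‖ ≤ 1) (ha : ‖a b‖ ≤ s) (hs : s ≤ 1)
    (x : Balaban1983to89.Site P j) : ‖mMat c u a b x‖ ≤ |c| * (2 * s) := by
  have hF : ‖F1 (a b)‖ ≤ 2 * s := (norm_F1_le (ha.trans hs)).trans (by linarith)
  have h0 : 0 ≤ |c| * (2 * s) := mul_nonneg (abs_nonneg c) ((norm_nonneg _).trans hF)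
  simp only [mMat, of_apply]
  split_ifs
  · calc ‖(c : ℂ) * u b * F1 (a b)‖ = |c| * ‖u b‖ * ‖F1 (a b)‖ := by
          rw [norm_mul, norm_mul, Complex.norm_real, Real.norm_eq_abs]
      _ ≤ |c| * 1 * (2 * s) := by gcongr
      _ = |c| * (2 * s) := by ring
  · simpa using h0

/-- **`M` alone is small as an operator** (sup norm): `‖(Mφ)(b)‖ ≤ |c|·2s·sup‖φ‖`. [cite: BalabanImbrieJaffe1988, (5.6.11) p.287] -/
theorem norm_mMat_mulVec_le {c s Φ : ℝ} {u a : PBond P j → ℂ} (hu : ∀ b, ‖u b‖ ≤ 1) (ha : ∀ b, ‖a b‖ ≤ s) (hs : s ≤ 1)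
    {φ : Balaban1983to89.Site P j → ℂ} (hφ : ∀ x, ‖φ x‖ ≤ Φ) (b : PBond P j) :
    ‖(mMat c u a *ᵥ φ) b‖ ≤ |c| * (2 * s) * Φ := by
  rw [mMat_mulVec, norm_mul]
  have h1 : ‖(c : ℂ) * u b * F1 (a b)‖ ≤ |c| * (2 * s) := by
    have := norm_mMat_le (c := c) (hu b) (ha b) hs b.tgt
    simpa [mMat] using this
  exact mul_le_mul h1 (hφ _) (norm_nonneg _) (mul_nonneg (abs_nonneg c) (by linarith [(norm_nonneg (a b)).trans (ha b)]))

omit [Fintype τ] in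
/-- **`F₂` is a bounded kernel of size `O(|w|·s′)`**: `‖F₂(y,x)‖ ≤ |w|·2s′` for `|U(y,x)| ≤ 1`, `‖A(y,x)‖ ≤ s′ ≤ 1`.
[cite: BalabanImbrieJaffe1988, (5.6.11) p.287] -/
theorem norm_f2Mat_le {α : Type*} [Fintype α] [DecidableEq α] {B : τ → Finset α} {w s : ℝ} {U A : τ → α → ℂ} {y : τ} {x : α}
    (hU : ‖U y x‖ ≤ 1) (hA : ‖A y x‖ ≤ s) (hs : s ≤ 1) : ‖f2Mat B w U A y x‖ ≤ |w| * (2 * s) := by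
  have hF : ‖F1 (A y x)‖ ≤ 2 * s := (norm_F1_le (hA.trans hs)).trans (by linarith)
  have h0 : 0 ≤ |w| * (2 * s) := mul_nonneg (abs_nonneg w) ((norm_nonneg _).trans hF)
  simp only [f2Mat, of_apply]
  split_ifs
  · calc ‖(w : ℂ) * U y x * F1 (A y x)‖ = |w| * ‖U y x‖ * ‖F1 (A y x)‖ := by
          rw [norm_mul, norm_mul, Complex.norm_real, Real.norm_eq_abs]
      _ ≤ |w| * 1 * (2 * s) := by gcongr
      _ = |w| * (2 * s) := by ring
  · simpa using h0

omit [Fintype τ] in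
/-- **`F₂` alone is small as an operator** (sup norm): `‖(F₂φ)(y)‖ ≤ |w|·|B(y)|·2s′·sup‖φ‖` (`= 2s′·sup‖φ‖` for the normalised
weight `|w|·|B(y)| = 1`, `w = L^{−ld}`, `|B_l(y)| = L^{ld}`). [cite: BalabanImbrieJaffe1988, (5.6.11) p.287] -/
theorem norm_f2Mat_mulVec_le {α : Type*} [Fintype α] [DecidableEq α] {B : τ → Finset α} {w s Φ : ℝ} {U A : τ → α → ℂ}
    (hU : ∀ y x, ‖U y x‖ ≤ 1) (hA : ∀ y x, ‖A y x‖ ≤ s) (hs : s ≤ 1) {φ : α → ℂ} (hφ : ∀ x, ‖φ x‖ ≤ Φ) (y : τ) :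
    ‖(f2Mat B w U A *ᵥ φ) y‖ ≤ |w| * (B y).card * (2 * s) * Φ := by
  rw [f2Mat_mulVec, F2]
  calc ‖∑ x ∈ B y, (w : ℂ) * U y x * φ x * F1 (A y x)‖
      ≤ ∑ x ∈ B y, ‖(w : ℂ) * U y x * φ x * F1 (A y x)‖ := norm_sum_le _ _
    _ ≤ ∑ x ∈ B y, |w| * (2 * s) * Φ := Finset.sum_le_sum fun x _ => by
        have h1 : ‖(w : ℂ) * U y x * F1 (A y x)‖ ≤ |w| * (2 * s) := by
          have := norm_f2Mat_le (B := B) (w := w) (hU y x) (hA y x) hs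
          simpa [f2Mat, *] using this
        calc ‖(w : ℂ) * U y x * φ x * F1 (A y x)‖ = ‖(w : ℂ) * U y x * F1 (A y x)‖ * ‖φ x‖ := by
              rw [show (w : ℂ) * U y x * φ x * F1 (A y x) = (w : ℂ) * U y x * F1 (A y x) * φ x by ring, norm_mul]
          _ ≤ |w| * (2 * s) * Φ := mul_le_mul h1 (hφ x) (norm_nonneg _)
              (mul_nonneg (abs_nonneg w) (by linarith [(norm_nonneg (A y x)).trans (hA y x)]))
    _ = |w| * (B y).card * (2 * s) * Φ := by rw [Finset.sum_const, nsmul_eq_mul]; ring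

/-- **the printed size `O(e_j^{1−α})`**: on the `ζ`-lattice `c = ζ⁻¹` and `a_b = ie_jζÃ^ζ_b`; if `|Ã^ζ_b| ≤ p` with `e_jζp ≤ 1` then
`‖M(b,x)‖ ≤ 2e_j·p` — the `ζ⁻¹` of the derivative cancels the `ζ` of the exponent (print: fields bounded by `p ≲ e_j^{−α}`, so
`O(e_jp) = O(e_j^{1−α})`). [cite: BalabanImbrieJaffe1988, (5.6.11) p.287] -/
theorem norm_mMat_le_printed {ζ ej p : ℝ} (hζ : 0 < ζ) (hej : 0 ≤ ej) {u a : PBond P j → ℂ} {At : PBond P j → ℝ}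
    (hu : ∀ b, ‖u b‖ ≤ 1) (ha : ∀ b, a b = I * (ej * ζ * At b : ℝ)) (hAt : ∀ b, |At b| ≤ p) (hsmall : ej * ζ * p ≤ 1)
    (b : PBond P j) (x : Balaban1983to89.Site P j) : ‖mMat ζ⁻¹ u a b x‖ ≤ 2 * ej * p := by
  have hab : ‖a b‖ ≤ ej * ζ * p := by
    rw [ha b, norm_mul, Complex.norm_I, one_mul, Complex.norm_real, Real.norm_eq_abs, abs_mul,
      abs_of_nonneg (mul_nonneg hej hζ.le)]
    exact mul_le_mul_of_nonneg_left (hAt b) (mul_nonneg hej hζ.le)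
  calc ‖mMat ζ⁻¹ u a b x‖ ≤ |ζ⁻¹| * (2 * (ej * ζ * p)) := norm_mMat_le (hu b) hab hsmall x
    _ = 2 * ej * p := by rw [abs_of_pos (inv_pos.mpr hζ)]; field_simp

/-! ## §4 (5.6.11) for these operators -/

/-- **(5.6.11)** for the operators of this file: if `G₀ = G_j(Ω, ũ_{k+1})` inverts `−Δ^N_{u,Ω} + a_jP_j(U)` and `G = G_j(Ω, ũ_{k+1}ũ)` inverts
the perturbed operator, then `G = G₀ + G₀V_j(Ω)G` (r16's `eq5611` with (5.6.10) `eq5610_matrix` inserted).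
[cite: BalabanImbrieJaffe1988, (5.6.11) p.287] -/
theorem eq5611_matrix (aj c : ℝ) (u a : PBond P j → ℂ) (χ : Matrix (PBond P j) (PBond P j) ℂ)
    (B : τ → Finset (Balaban1983to89.Site P j)) (w : ℝ) (U A : τ → Balaban1983to89.Site P j → ℂ)
    {G₀ G : Matrix (Balaban1983to89.Site P j) (Balaban1983to89.Site P j) ℂ} (h₀ : G₀ * hMat aj c u χ B w U = 1)
    (h : hMat aj c (fun b => u b * exp (a b)) χ B w (fun y x => U y x * exp (A y x)) * G = 1) :
    G = G₀ + G₀ * vjMat aj c u a χ B w U A * G := by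
  rw [eq5610_matrix] at h
  exact eq5611 h₀ h

end Operators

end

end Literature.MathematicalPhysics.QuantumFieldTheory.BalabanImbrieJaffe1984to88.BIJ88Vj5610Operator
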